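import Literature.Analysis.FluidPDE.OseenKernelJointSmooth
import Literature.Analysis.FluidPDE.OseenKernelScaling
import Mathlib.MeasureTheory.Measure.Haar.NormedSpace
import HarnessLib

/-!
# Parabolic scaling of the joint derivatives of the Oseen kernel; the sharp small-time bounds

Analysis/FluidPDE support file (everything proved) on the discharge path of the named fact
`Literature.Analysis.FluidPDE.knss2009_local_smoothing` (`NSBoundedMildSmoothing.lean`;
Koch–Nadirashvili–Seregin–Šverák 2009, Prop. 4.1). `OseenKernelJointSmooth.lean` bounds the
joint derivatives `D^m_{(σ,z)} K(σ, z)` of the kernel of `e^{σΔ}P∇·` (`K = oseenKernelCLM`) on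
compact time ranges `[σ_a, σ_b] ⊂ (0, ∞)`; the Picard iteration for Prop. 4.1 needs their size as
`σ → 0⁺`, which the parabolic homogeneity `K(λ²σ, λz) = λ^{-(d+1)} K(σ, z)`
(`oseenKernel_sq_mul_smul`, `OseenKernelScaling.lean`; Koch–Tataru 2001, (8), (14)) provides:

* `oseenKernelCLM_sq_mul_smul`: the homogeneity for the operator-valued kernel;
* `iteratedFDeriv_oseenKernelCLM_prod_dilate_apply`: the chain rule under the parabolic dilation
  `S_λ(σ, z) = (λ²σ, λz)` — `D^m K(λ²σ, λz)[S_λ V₁, …, S_λ V_m] = λ^{-(d+1)} D^m K(σ, z)[V₁, …, V_m]`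
  (`ContinuousLinearMap.iteratedFDerivWithin_comp_right` on the half-space, which `S_λ`
  preserves; `S_λ` is the linear map `(λ² • fst).prod (λ • snd)`);
* `norm_iteratedFDeriv_oseenKernelCLM_prod_dilate_le`: for `0 < λ ≤ 1`,
  `‖D^m K(λ²σ, λz)‖ ≤ λ^{-(d+1)} λ^{-2m} ‖D^m K(σ, z)‖` (`‖S_λ⁻¹‖ ≤ λ⁻²`);
* `exists_norm_iteratedFDeriv_oseenKernelCLM_prod_le_rpow`,
  `exists_integral_norm_iteratedFDeriv_oseenKernelCLM_prod_le_rpow`: the **sharp small-time bounds**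
  `‖D^m K(σ, z)‖ ≤ C σ^{-(d+1)/2 - m}` and `∫ ‖D^m K(σ, z)‖ dz ≤ C σ^{-1/2 - m}` for
  `0 < σ ≤ W` (any `W`; `λ = √σ`, the reference time `1`, and the change of variables
  `z = λζ`), the all-order version of KNSS's "obvious estimates" (3.5)–(3.6) and of the weight
  `√T` in (4.4) (one power `σ^{-1/2}` from `‖K(σ, ·)‖₁`, and `σ⁻¹` per joint derivative, time and
  space alike — the isotropic form sufficient at unit parabolic scale).

## References

* G. Koch, N. Nadirashvili, G. Seregin, V. Šverák, Acta Math. 203 (2009) = arXiv:0709.3599,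
  §1 (1.3) (scaling), §3 (3.5)–(3.6), §4 (4.4), Prop. 4.1. [KochNadirashviliSereginSverak2009]
* H. Koch, D. Tataru, Adv. Math. 157 (2001), §2 (8), §3 (14). [KochTataruAdvMath2001]
-/

noncomputable section

open MeasureTheory Set Function Filter Metric Real
open _root_.Topology
open scoped ENNReal NNReal RealInnerProductSpace

namespace Literature.Analysis.FluidPDE

variable {E : Type*} [NormedAddCommGroup E] [InnerProductSpace ℝ E] [FiniteDimensional ℝ E]
  [MeasurableSpace E] [BorelSpace E]

/-! ### The parabolic dilation and the homogeneity of the kernel -/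

section Dilation

omit [FiniteDimensional ℝ E] [MeasurableSpace E] [BorelSpace E] in
/-- **Homogeneity of the operator-valued kernel**: `K(λ²σ, λz) = λ^{-(d+1)} K(σ, z)` for `λ > 0`,
`σ > 0`. [cite: KochTataruAdvMath2001, §2 (8) and §3 (14)] -/
theorem oseenKernelCLM_sq_mul_smul {lam : ℝ} (hl : 0 < lam) {σ : ℝ} (hσ : 0 < σ) (z : E) :
    oseenKernelCLM (lam ^ 2 * σ) (lam • z) = (lam ^ (Module.finrank ℝ E + 1))⁻¹ • oseenKernelCLM σ z := by
  ext a b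
  simp only [oseenKernelCLM_apply, smul_apply]
  exact oseenKernel_sq_mul_smul hl hσ z a b

omit [FiniteDimensional ℝ E] [MeasurableSpace E] [BorelSpace E] in
/-- Scalar multiples of bilinear-operator-valued quantities: `‖c • T‖ ≤ |c| ‖T‖` (recorded because
the `NormSMulClass` instance is not found by instance search on the iterated operator type).
[folklore] -/
theorem norm_smul_clm_clm_le (c : ℝ) (T : E →L[ℝ] E →L[ℝ] E) : ‖c • T‖ ≤ |c| * ‖T‖ := by
  refine ContinuousLinearMap.opNorm_le_bound _ (by positivity) fun a => ?_
  rw [smul_apply, norm_smul, Real.norm_eq_abs, mul_assoc]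
  exact mul_le_mul_of_nonneg_left (T.le_opNorm a) (abs_nonneg c)

omit [InnerProductSpace ℝ E] [FiniteDimensional ℝ E] [MeasurableSpace E] [BorelSpace E] in
/-- The inverse dilation contracts by at most `λ⁻²` for `0 < λ ≤ 1`:
`‖(λ⁻² a, λ⁻¹ v)‖ ≤ λ⁻² ‖(a, v)‖`. [folklore] -/
theorem norm_inv_dilate_le [NormedSpace ℝ E] {lam : ℝ} (hl : 0 < lam) (hl1 : lam ≤ 1) (V : ℝ × E) :
    ‖(((lam ^ 2)⁻¹ * V.1, lam⁻¹ • V.2) : ℝ × E)‖ ≤ (lam ^ 2)⁻¹ * ‖V‖ := by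
  have hl2 : 0 < lam ^ 2 := by positivity
  have hle : lam⁻¹ ≤ (lam ^ 2)⁻¹ := by
    rw [inv_le_inv₀ hl hl2]
    nlinarith
  rw [Prod.norm_def, Prod.norm_def]
  refine max_le ?_ ?_
  · rw [norm_mul, norm_inv, norm_pow, Real.norm_of_nonneg hl.le]
    exact mul_le_mul_of_nonneg_left (le_max_left _ _) (by positivity)
  · rw [norm_smul, norm_inv, Real.norm_of_nonneg hl.le]
    exact mul_le_mul hle (le_max_right _ _) (norm_nonneg _) (by positivity)

/-- **Chain rule under the parabolic dilation**: for `λ > 0`, `σ > 0` and vectors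
`V_i = (a_i, v_i)`, `D^m K(λ²σ, λz)[(λ²a_1, λv_1), …, (λ²a_m, λv_m)] = λ^{-(d+1)} D^m K(σ, z)[V₁, …, V_m]`
(differentiate `K ∘ S_λ = λ^{-(d+1)} K` on the half-space, `S_λ(σ, z) = (λ²σ, λz)`).
[cite: KochTataruAdvMath2001, §3 (14)] -/
theorem iteratedFDeriv_oseenKernelCLM_prod_dilate_apply {lam : ℝ} (hl : 0 < lam) (m : ℕ) {σ : ℝ}
    (hσ : 0 < σ) (z : E) (V : Fin m → ℝ × E) :
    iteratedFDeriv ℝ m (fun r : ℝ × E => oseenKernelCLM r.1 r.2) ((lam ^ 2 * σ, lam • z) : ℝ × E)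
        (fun i => ((lam ^ 2 * (V i).1, lam • (V i).2) : ℝ × E)) =
      (lam ^ (Module.finrank ℝ E + 1))⁻¹ •
        iteratedFDeriv ℝ m (fun r : ℝ × E => oseenKernelCLM r.1 r.2) ((σ, z) : ℝ × E) V := by
  set U : Set (ℝ × E) := Ioi 0 ×ˢ univ with hU
  have hopen : IsOpen U := isOpen_Ioi.prod isOpen_univ
  have hUd : UniqueDiffOn ℝ U := hopen.uniqueDiffOn
  -- the parabolic dilation as a continuous linear map
  set S : ℝ × E →L[ℝ] ℝ × E :=
    ((lam ^ 2) • ContinuousLinearMap.fst ℝ ℝ E).prod (lam • ContinuousLinearMap.snd ℝ ℝ E) with hS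
  have hSap : ∀ p : ℝ × E, S p = ((lam ^ 2 * p.1, lam • p.2) : ℝ × E) := fun p => by
    simp [hS]
  have hpre : S ⁻¹' U = U := by
    ext p
    simp only [mem_preimage, hSap, hU, mem_prod, mem_Ioi, mem_univ, and_true]
    exact mul_pos_iff_of_pos_left (by positivity)
  have hp : ((σ, z) : ℝ × E) ∈ U := mk_mem_prod hσ (mem_univ _)
  have hSp : S ((σ, z) : ℝ × E) = ((lam ^ 2 * σ, lam • z) : ℝ × E) := hSap _
  have hSpU : S ((σ, z) : ℝ × E) ∈ U := by
    rw [hSp]; exact mk_mem_prod (mul_pos (by positivity) hσ) (mem_univ _)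
  -- chain rule within `U`
  have hchain := ContinuousLinearMap.iteratedFDerivWithin_comp_right S (f := fun r : ℝ × E =>
    oseenKernelCLM r.1 r.2) (s := U) (x := (σ, z)) (i := m) (n := ((⊤ : ℕ∞) : WithTop ℕ∞))
    contDiffOn_oseenKernelCLM_prod hUd (by rw [hpre]; exact hUd) hSpU (by exact_mod_cast le_top)
  rw [hpre] at hchain
  -- `K ∘ S = λ^{-(d+1)} K` on `U`
  have hfun : EqOn ((fun r : ℝ × E => oseenKernelCLM r.1 r.2) ∘ S)
      (fun r : ℝ × E => (lam ^ (Module.finrank ℝ E + 1))⁻¹ • oseenKernelCLM r.1 r.2) U := by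
    intro r hr
    simp only [comp_apply, hSap]
    exact oseenKernelCLM_sq_mul_smul hl (mem_prod.1 hr).1 r.2
  have hsmul : iteratedFDerivWithin ℝ m
      (fun r : ℝ × E => (lam ^ (Module.finrank ℝ E + 1))⁻¹ • oseenKernelCLM r.1 r.2) U (σ, z) =
      (lam ^ (Module.finrank ℝ E + 1))⁻¹ •
        iteratedFDerivWithin ℝ m (fun r : ℝ × E => oseenKernelCLM r.1 r.2) U (σ, z) :=
    iteratedFDerivWithin_const_smul_apply (a := (lam ^ (Module.finrank ℝ E + 1))⁻¹)
      (f := fun r : ℝ × E => oseenKernelCLM r.1 r.2)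
      ((contDiffOn_oseenKernelCLM_prod (E := E) (σ, z) hp).of_le (by exact_mod_cast le_top)) hUd hp
  have key : (iteratedFDerivWithin ℝ m (fun r : ℝ × E => oseenKernelCLM r.1 r.2) U (S (σ, z))).compContinuousLinearMap
      (fun _ => S) = (lam ^ (Module.finrank ℝ E + 1))⁻¹ •
        iteratedFDerivWithin ℝ m (fun r : ℝ × E => oseenKernelCLM r.1 r.2) U (σ, z) := by
    rw [← hchain, iteratedFDerivWithin_congr hfun hp, hsmul]
  -- evaluate at `V` and pass to `iteratedFDeriv` (open set)
  have h := congr_arg (fun A : ContinuousMultilinearMap ℝ (fun _ : Fin m => ℝ × E) (E →L[ℝ] E →L[ℝ] E) => A V) key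
  simp only [ContinuousMultilinearMap.compContinuousLinearMap_apply, smul_apply] at h
  rw [iteratedFDerivWithin_of_isOpen m hopen hSpU, iteratedFDerivWithin_of_isOpen m hopen hp, hSp] at h
  have hSV : (fun i => S (V i)) = fun i => ((lam ^ 2 * (V i).1, lam • (V i).2) : ℝ × E) :=
    funext fun i => hSap _
  rw [hSV] at h
  exact h

/-- **Norm form of the parabolic scaling of the joint derivatives**: for `0 < λ ≤ 1`, `σ > 0`,
`‖D^m K(λ²σ, λz)‖ ≤ λ^{-(d+1)} λ^{-2m} ‖D^m K(σ, z)‖`. [cite: KochTataruAdvMath2001, §3 (14)] -/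
theorem norm_iteratedFDeriv_oseenKernelCLM_prod_dilate_le {lam : ℝ} (hl : 0 < lam) (hl1 : lam ≤ 1)
    (m : ℕ) {σ : ℝ} (hσ : 0 < σ) (z : E) :
    ‖iteratedFDeriv ℝ m (fun r : ℝ × E => oseenKernelCLM r.1 r.2) ((lam ^ 2 * σ, lam • z) : ℝ × E)‖ ≤
      (lam ^ (Module.finrank ℝ E + 1))⁻¹ * ((lam ^ 2)⁻¹) ^ m *
        ‖iteratedFDeriv ℝ m (fun r : ℝ × E => oseenKernelCLM r.1 r.2) ((σ, z) : ℝ × E)‖ := by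
  have hl0 : lam ≠ 0 := hl.ne'
  have hc0 : 0 ≤ (lam ^ (Module.finrank ℝ E + 1))⁻¹ := by positivity
  refine ContinuousMultilinearMap.opNorm_le_bound (by positivity) fun V => ?_
  obtain ⟨W, hW⟩ : ∃ W : Fin m → ℝ × E, ∀ i, W i = (((lam ^ 2)⁻¹ * (V i).1, lam⁻¹ • (V i).2) : ℝ × E) :=
    ⟨_, fun i => rfl⟩
  have hV : (fun i => ((lam ^ 2 * (W i).1, lam • (W i).2) : ℝ × E)) = V := by
    funext i
    rw [hW]
    ext
    · simp only
      field_simp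
    · simp only [smul_smul, mul_inv_cancel₀ hl0, one_smul]
  have hWn : ∀ i, ‖W i‖ ≤ (lam ^ 2)⁻¹ * ‖V i‖ := fun i => by rw [hW]; exact norm_inv_dilate_le hl hl1 (V i)
  have hprod : ∏ i, ‖W i‖ ≤ ∏ i, ((lam ^ 2)⁻¹ * ‖V i‖) :=
    Finset.prod_le_prod (fun i _ => norm_nonneg _) fun i _ => hWn i
  calc ‖iteratedFDeriv ℝ m (fun r : ℝ × E => oseenKernelCLM r.1 r.2) ((lam ^ 2 * σ, lam • z) : ℝ × E) V‖
      = ‖(lam ^ (Module.finrank ℝ E + 1))⁻¹ •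
          iteratedFDeriv ℝ m (fun r : ℝ × E => oseenKernelCLM r.1 r.2) ((σ, z) : ℝ × E) W‖ := by
        rw [← hV, iteratedFDeriv_oseenKernelCLM_prod_dilate_apply hl m hσ z W]
    _ ≤ |(lam ^ (Module.finrank ℝ E + 1))⁻¹| *
          ‖iteratedFDeriv ℝ m (fun r : ℝ × E => oseenKernelCLM r.1 r.2) ((σ, z) : ℝ × E) W‖ :=
        norm_smul_clm_clm_le _ _
    _ = (lam ^ (Module.finrank ℝ E + 1))⁻¹ *
          ‖iteratedFDeriv ℝ m (fun r : ℝ × E => oseenKernelCLM r.1 r.2) ((σ, z) : ℝ × E) W‖ := by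
        rw [abs_of_nonneg hc0]
    _ ≤ (lam ^ (Module.finrank ℝ E + 1))⁻¹ *
          (‖iteratedFDeriv ℝ m (fun r : ℝ × E => oseenKernelCLM r.1 r.2) ((σ, z) : ℝ × E)‖ * ∏ i, ‖W i‖) :=
        mul_le_mul_of_nonneg_left (ContinuousMultilinearMap.le_opNorm _ _) hc0
    _ ≤ (lam ^ (Module.finrank ℝ E + 1))⁻¹ *
          (‖iteratedFDeriv ℝ m (fun r : ℝ × E => oseenKernelCLM r.1 r.2) ((σ, z) : ℝ × E)‖ *
            ∏ i, ((lam ^ 2)⁻¹ * ‖V i‖)) :=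
        mul_le_mul_of_nonneg_left (mul_le_mul_of_nonneg_left hprod (norm_nonneg _)) hc0
    _ = (lam ^ (Module.finrank ℝ E + 1))⁻¹ * ((lam ^ 2)⁻¹) ^ m *
          ‖iteratedFDeriv ℝ m (fun r : ℝ × E => oseenKernelCLM r.1 r.2) ((σ, z) : ℝ × E)‖ *
            ∏ i, ‖V i‖ := by
        rw [Finset.prod_mul_distrib, Finset.prod_const, Finset.card_univ, Fintype.card_fin]
        ring

end Dilation

/-! ### The sharp small-time bounds -/

section SmallTime

/-- Powers of `√σ`: `(√σ)^{-(d+1)} (√σ)^{-2m} = σ^{-(d+1)/2 - m}` for `σ > 0`. [folklore] -/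
theorem sqrt_pow_inv_mul_eq_rpow {σ : ℝ} (hσ : 0 < σ) (d m : ℕ) :
    (Real.sqrt σ ^ (d + 1))⁻¹ * ((Real.sqrt σ ^ 2)⁻¹) ^ m = σ ^ (-(((d : ℝ) + 1) / 2) - m) := by
  rw [Real.sq_sqrt hσ.le, ← Real.rpow_natCast (Real.sqrt σ), Real.sqrt_eq_rpow, ← Real.rpow_mul hσ.le,
    ← Real.rpow_neg hσ.le, inv_pow, ← Real.rpow_natCast σ m, ← Real.rpow_neg hσ.le,
    ← Real.rpow_add hσ]
  congr 1
  push_cast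
  ring

/-- **Scaling to the reference time**: for `0 < σ ≤ 1`,
`‖D^m K(σ, z)‖ ≤ σ^{-(d+1)/2 - m} ‖D^m K(1, z/√σ)‖` (`λ = √σ` in the dilation bound).
[cite: KochNadirashviliSereginSverak2009, §3 (3.5)–(3.6) (arXiv:0709.3599 p. 6)] -/
theorem norm_iteratedFDeriv_oseenKernelCLM_prod_le_rpow_mul (m : ℕ) {σ : ℝ} (hσ0 : 0 < σ) (hσ1 : σ ≤ 1)
    (z : E) :
    ‖iteratedFDeriv ℝ m (fun r : ℝ × E => oseenKernelCLM r.1 r.2) (σ, z)‖ ≤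
      σ ^ (-(((Module.finrank ℝ E : ℝ) + 1) / 2) - m) *
        ‖iteratedFDeriv ℝ m (fun r : ℝ × E => oseenKernelCLM r.1 r.2) ((1, (Real.sqrt σ)⁻¹ • z) : ℝ × E)‖ := by
  have hs : 0 < Real.sqrt σ := Real.sqrt_pos.2 hσ0
  have hs1 : Real.sqrt σ ≤ 1 := Real.sqrt_le_one.2 hσ1 |>.trans_eq' (by simp)
  have hsc := norm_iteratedFDeriv_oseenKernelCLM_prod_dilate_le hs hs1 m one_pos ((Real.sqrt σ)⁻¹ • z)
  rw [sqrt_pow_inv_mul_eq_rpow hσ0 (Module.finrank ℝ E) m, mul_one, Real.sq_sqrt hσ0.le, smul_smul,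
    mul_inv_cancel₀ hs.ne', one_smul] at hsc
  exact hsc

/-- From a bound on `[1, max 1 W]` to a bound by `σ^e` (`e ≤ 0`) on `1 ≤ σ ≤ W`. [folklore] -/
theorem le_mul_rpow_of_one_le {C₂ W e σ B : ℝ} (hC₂ : 0 ≤ C₂) (he0 : e ≤ 0) (hσ1 : 1 ≤ σ)
    (hσW : σ ≤ max 1 W) (hB : B ≤ C₂) : B ≤ C₂ * (max 1 W) ^ (-e) * σ ^ e := by
  have hσ0 : 0 < σ := one_pos.trans_le hσ1
  have hpow : 1 ≤ (max 1 W) ^ (-e) * σ ^ e := by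
    have h3 : (max 1 W) ^ e ≤ σ ^ e := Real.rpow_le_rpow_of_nonpos hσ0 hσW he0
    have h4 : (max 1 W) ^ (-e) * (max 1 W) ^ e = 1 := by
      rw [← Real.rpow_add (by positivity), neg_add_cancel, Real.rpow_zero]
    calc (1 : ℝ) = (max 1 W) ^ (-e) * (max 1 W) ^ e := h4.symm
      _ ≤ (max 1 W) ^ (-e) * σ ^ e := mul_le_mul_of_nonneg_left h3 (Real.rpow_nonneg (by positivity) _)
  calc B ≤ C₂ := hB
    _ = C₂ * 1 := (mul_one _).symm
    _ ≤ C₂ * ((max 1 W) ^ (-e) * σ ^ e) := mul_le_mul_of_nonneg_left hpow hC₂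
    _ = C₂ * (max 1 W) ^ (-e) * σ ^ e := by ring

/-- **Sharp small-time sup bound for the joint derivatives of the kernel**: for every `m` and
`W` there is `C ≥ 0` with `‖D^m_{(σ,z)} K(σ, z)‖ ≤ C σ^{-(d+1)/2 - m}` for `0 < σ ≤ W`, all `z`
(scaling to the reference time `1` for `σ ≤ 1`, the compact-range bound on `[1, W]`). KNSS 2009,
(3.5)–(3.6) (all orders). [cite: KochNadirashviliSereginSverak2009, §3 (3.5)–(3.6) (arXiv:0709.3599 p. 6)] -/
theorem exists_norm_iteratedFDeriv_oseenKernelCLM_prod_le_rpow (m : ℕ) (W : ℝ) :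
    ∃ C : ℝ, 0 ≤ C ∧ ∀ σ ∈ Ioc 0 W, ∀ z : E,
      ‖iteratedFDeriv ℝ m (fun r : ℝ × E => oseenKernelCLM r.1 r.2) (σ, z)‖ ≤
        C * σ ^ (-(((Module.finrank ℝ E : ℝ) + 1) / 2) - m) := by
  obtain ⟨C₁, hC₁, h1⟩ := exists_norm_iteratedFDeriv_oseenKernelCLM_prod_le_const (E := E) m one_pos le_rfl
  obtain ⟨C₂, hC₂, h2⟩ := exists_norm_iteratedFDeriv_oseenKernelCLM_prod_le_const (E := E) m one_pos
    (le_max_left 1 W)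
  have he0 : -(((Module.finrank ℝ E : ℝ) + 1) / 2) - (m : ℝ) ≤ 0 := by
    have : (0 : ℝ) ≤ (Module.finrank ℝ E : ℝ) := by positivity
    have : (0 : ℝ) ≤ (m : ℝ) := by positivity
    linarith
  refine ⟨max C₁ (C₂ * (max 1 W) ^ (-(-(((Module.finrank ℝ E : ℝ) + 1) / 2) - (m : ℝ)))),
    le_max_of_le_left hC₁, fun σ hσ z => ?_⟩
  have hσ0 : 0 < σ := hσ.1
  rcases le_or_gt σ 1 with hσ1 | hσ1
  · refine (norm_iteratedFDeriv_oseenKernelCLM_prod_le_rpow_mul m hσ0 hσ1 z).trans ?_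
    rw [mul_comm]
    refine mul_le_mul_of_nonneg_right ((h1 1 ⟨le_rfl, le_rfl⟩ _).trans (le_max_left _ _))
      (Real.rpow_nonneg hσ0.le _)
  · have hσW : σ ≤ max 1 W := hσ.2.trans (le_max_right _ _)
    refine (le_mul_rpow_of_one_le hC₂ he0 hσ1.le hσW (h2 σ ⟨hσ1.le, hσW⟩ z)).trans ?_
    exact mul_le_mul_of_nonneg_right (le_max_right _ _) (Real.rpow_nonneg hσ0.le _)

/-- **Sharp small-time `L¹` bound for the joint derivatives of the kernel**: for every `m` and
`W` there is `C ≥ 0` with `∫ ‖D^m_{(σ,z)} K(σ, z)‖ dz ≤ C σ^{-1/2 - m}` for `0 < σ ≤ W`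
(scaling and the change of variables `z = √σ ζ` for `σ ≤ 1`, the compact-range bound on `[1, W]`),
together with the integrability in `z`. The all-order form of the weight `√T` in KNSS's (4.4)
(`‖K(σ, ·)‖₁ ≲ σ^{-1/2}`), each joint derivative costing `σ⁻¹`. [cite: KochNadirashviliSereginSverak2009, §3 (3.5)–(3.6) and §4 (4.4) (arXiv:0709.3599 pp. 6–8)] -/
theorem exists_integral_norm_iteratedFDeriv_oseenKernelCLM_prod_le_rpow (m : ℕ) (W : ℝ) :
    ∃ C : ℝ, 0 ≤ C ∧ ∀ σ ∈ Ioc 0 W,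
      Integrable (fun z : E => iteratedFDeriv ℝ m (fun r : ℝ × E => oseenKernelCLM r.1 r.2) (σ, z)) ∧
      ∫ z, ‖iteratedFDeriv ℝ m (fun r : ℝ × E => oseenKernelCLM r.1 r.2) (σ, z)‖ ≤
        C * σ ^ (-(1 / 2 : ℝ) - m) := by
  obtain ⟨C₁, hC₁, h1⟩ := exists_integral_norm_iteratedFDeriv_oseenKernelCLM_prod_le (E := E) m one_pos le_rfl
  obtain ⟨C₂, hC₂, h2⟩ := exists_integral_norm_iteratedFDeriv_oseenKernelCLM_prod_le (E := E) m one_pos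
    (le_max_left 1 W)
  have he0 : -(1 / 2 : ℝ) - (m : ℝ) ≤ 0 := by
    have : (0 : ℝ) ≤ (m : ℝ) := by positivity
    linarith
  -- integrability at every `σ > 0` (compact range `[σ, σ]`)
  have hint : ∀ {σ : ℝ}, 0 < σ →
      Integrable (fun z : E => iteratedFDeriv ℝ m (fun r : ℝ × E => oseenKernelCLM r.1 r.2) (σ, z)) := by
    intro σ hσ
    obtain ⟨_, _, h⟩ := exists_integral_norm_iteratedFDeriv_oseenKernelCLM_prod_le (E := E) m hσ le_rfl
    exact (h σ ⟨le_rfl, le_rfl⟩).1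
  refine ⟨max C₁ (C₂ * (max 1 W) ^ (-(-(1 / 2 : ℝ) - (m : ℝ)))), le_max_of_le_left hC₁,
    fun σ hσ => ⟨hint hσ.1, ?_⟩⟩
  have hσ0 : 0 < σ := hσ.1
  rcases le_or_gt σ 1 with hσ1 | hσ1
  · -- scaling and the change of variables `z = √σ • ζ`
    have hs : 0 < Real.sqrt σ := Real.sqrt_pos.2 hσ0
    set e' : ℝ := -(((Module.finrank ℝ E : ℝ) + 1) / 2) - m with he'
    -- the change of variables
    have hcv : ∫ z : E, ‖iteratedFDeriv ℝ m (fun r : ℝ × E => oseenKernelCLM r.1 r.2)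
        ((1, (Real.sqrt σ)⁻¹ • z) : ℝ × E)‖ = Real.sqrt σ ^ Module.finrank ℝ E *
          ∫ ζ : E, ‖iteratedFDeriv ℝ m (fun r : ℝ × E => oseenKernelCLM r.1 r.2) ((1, ζ) : ℝ × E)‖ := by
      have h := Measure.integral_comp_smul (μ := (volume : Measure E))
        (fun ζ : E => ‖iteratedFDeriv ℝ m (fun r : ℝ × E => oseenKernelCLM r.1 r.2) ((1, ζ) : ℝ × E)‖)
        (Real.sqrt σ)⁻¹
      rw [h, smul_eq_mul, inv_pow, inv_inv, abs_of_pos (pow_pos hs _)]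
    have hpowid : σ ^ e' * Real.sqrt σ ^ Module.finrank ℝ E = σ ^ (-(1 / 2 : ℝ) - m) := by
      rw [he', Real.sqrt_eq_rpow, ← Real.rpow_natCast (σ ^ (1 / 2 : ℝ)), ← Real.rpow_mul hσ0.le,
        ← Real.rpow_add hσ0]
      congr 1
      ring
    calc ∫ z, ‖iteratedFDeriv ℝ m (fun r : ℝ × E => oseenKernelCLM r.1 r.2) (σ, z)‖
        ≤ ∫ z, σ ^ e' *
            ‖iteratedFDeriv ℝ m (fun r : ℝ × E => oseenKernelCLM r.1 r.2) ((1, (Real.sqrt σ)⁻¹ • z) : ℝ × E)‖ := by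
          refine integral_mono_of_nonneg (Eventually.of_forall fun _ => norm_nonneg _) ?_
            (Eventually.of_forall fun z => norm_iteratedFDeriv_oseenKernelCLM_prod_le_rpow_mul m hσ0 hσ1 z)
          refine Integrable.const_mul ?_ _
          exact (hint one_pos).norm.comp_smul (R := (Real.sqrt σ)⁻¹) (inv_ne_zero hs.ne')
      _ = σ ^ e' * (Real.sqrt σ ^ Module.finrank ℝ E *
            ∫ ζ : E, ‖iteratedFDeriv ℝ m (fun r : ℝ × E => oseenKernelCLM r.1 r.2) ((1, ζ) : ℝ × E)‖) := by
          rw [integral_const_mul, hcv]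
      _ ≤ σ ^ e' * (Real.sqrt σ ^ Module.finrank ℝ E * C₁) :=
          mul_le_mul_of_nonneg_left (mul_le_mul_of_nonneg_left (h1 1 ⟨le_rfl, le_rfl⟩).2 (by positivity))
            (Real.rpow_nonneg hσ0.le _)
      _ = C₁ * σ ^ (-(1 / 2 : ℝ) - m) := by rw [← hpowid]; ring
      _ ≤ max C₁ (C₂ * (max 1 W) ^ (-(-(1 / 2 : ℝ) - (m : ℝ)))) * σ ^ (-(1 / 2 : ℝ) - m) :=
          mul_le_mul_of_nonneg_right (le_max_left _ _) (Real.rpow_nonneg hσ0.le _)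
  · have hσW : σ ≤ max 1 W := hσ.2.trans (le_max_right _ _)
    refine (le_mul_rpow_of_one_le hC₂ he0 hσ1.le hσW (h2 σ ⟨hσ1.le, hσW⟩).2).trans ?_
    exact mul_le_mul_of_nonneg_right (le_max_right _ _) (Real.rpow_nonneg hσ0.le _)

end SmallTime

end Literature.Analysis.FluidPDE

end
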